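import Literature.NumberTheory.EllipticCurves.Sprung2017.SharpFlatPAdicLFunction
import Mathlib.Algebra.Polynomial.Derivative
import HarnessLib

/-!
# Blind-point calculus at `T = −2`, `p = 2`: values AND DERIVATIVES of `u_n`, `v_n`, `ω_n`
# (cell `b2b-bsdres`, O1 sub-cell `p = 2`; cc-typer-4 GEN 7, typer item (27″) "9b as a theorem",
# preliminaries 2/2)

HONEST FRAMING (run/shared/lean/b2b/bsd-rank1-residual/, verbatim in every file): the goal of the
cell is to DELETE the COMBINATION-SHAPED residual classes of the Birch–Swinnerton-Dyer formula for
ALL analytic-rank `≤ 1` elliptic curves over `ℚ` — "full BSD formula for every rank `≤ 1` curve in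
class `C`" assembled STRICTLY from published theorems — so that the rank-`≤ 1` remainder becomes
exactly the CONSTRUCTION-SHAPED classes, which are TYPED (missing-input `Prop`s), NOT attempted.
This is not "finishing BSD". THEOREMS ONLY plus five `ℤ`-valued abbreviations (`cSeq`, `dSeq`,
`eSeq`, `qSeq`, `pSum`: values / derivatives of Sprung's recursion polynomials at the blind point and
their telescoping sums); pure algebra about `u_n = sharpPoly a 2 n`, `v_n = flatPoly a 2 n` and
`ω_n` at the point `T = −2`; nothing about any curve is asserted; nothing booked; no label moves.

PURPOSE. The companion file `BlindPointFlatTwo.lean` proves lens-1's blind `♭`-law 9b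
(`5·L♭(−2) + a₂·L♯(−2) = 0` at a good supersingular `2` with `a₂ = ±2` and `w(E ⊗ χ₈) = +1`) by a
FINITE-LEVEL route: one differentiates the integral Sprung congruences
`Θ_n + u_n L♯ + v_n L♭ = ω_n R_n` and the Mazur–Tate functional equation at the second fixed point
`T = −2` of `1 + T ↦ (1+T)⁻¹` and eliminates `L♯′(−2)` between two consecutive levels. This file
supplies the bookkeeping that route needs:

* §2 at `p = 2`, `t = −2`: `ω_n(−2) = 0`, `ω_n′(−2) = −2ⁿ` (`n ≥ 1`), `Φ_2(1+T) = T + 2` has value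
  `0` and derivative `1`, `Φ_{2^{m+2}}(1+T) = (1+T)^{2^{m+1}} + 1` has value `2` and derivative
  `−2^{m+1}`;
* §3 the integer sequences `c_n := u_n(−2)`, `d_n := u_n′(−2)`, `e_n := v_n′(−2)`:
  `c_{n+2} = a c_{n+1} − 2 c_n` (`c_0 = 0`, `c_1 = 1` — a Lucas sequence), `e_{n+1} = −c_n`,
  `d_{n+3} = a d_{n+2} − 2 d_{n+1} + 2^{n+1} c_{n+1}` (`d_0 = d_1 = d_2 = 0`), the Cassini identity
  `c_n c_{n+2} − c_{n+1}² = −2ⁿ`, the Wronskian sum `d_{n+2} c_{n+1} − d_{n+1} c_{n+2} =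
  2ⁿ · Σ_{k<n} c_{k+1}c_{k+2}`, the telescoping identity
  `(9 − a²) · Σ_{k<n} c_{k+1}c_{k+2} = Q_{n+1} − a` with `Q_k = 4a c_k² − (a²+3) c_k c_{k+1} + a c_{k+1}²`
  (`Q_{k+1} − Q_k = (9 − a²) c_k c_{k+1}`), and the `2`-adic decay `2 ∣ a ⇒ 2^k ∣ c_n` for
  `2k + 1 ≤ n`.

(§1, the `evalAt` / `derivAt` calculus on `ℤ_p⟦T⟧`, is the sibling `BlindPointDerivAt.lean`; this file is
pure polynomial algebra over `ℤ` and does not import it.) All statements are exact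
identities in `ℤ`; every proof is elementary (recursions + `ring`). References for the objects:
F. Sprung, ANT 11 (2017) Cor. 4.4 (the recursion `x_{n+2} = a_p x_{n+1} − Φ_{p^{n+1}}(1+T) x_n`)
[Sprung2017]; R. Pollack, Duke Math. J. 118 (2003) Thm. 6.17 (`ω_n`) [Pollack2003]. Folder record:
`HOME/class-closure/O1/TYPING.md` §10.
-/

set_option autoImplicit false

noncomputable section

open Polynomial Literature.NumberTheory.EllipticCurves
  Literature.NumberTheory.EllipticCurves.Sprung2017

namespace Summit.BirchSwinnertonDyer.Rank1Residual.Supersingular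

/-! ## §2. `ω_n` and the cyclotomic factors at `T = −2` (over `ℤ`) -/

namespace BlindFlat

/-- `ω_n(−2) = (−1)^{2ⁿ} − 1 = 0` in `ℤ`, for `n ≥ 1`. [folklore] -/
theorem eval_neg_two_cyclotomicOmega {n : ℕ} (hn : 1 ≤ n) :
    (cyclotomicOmega 2 n).eval (-2 : ℤ) = 0 := by
  have hev : Even (2 ^ n) := Nat.even_pow.mpr ⟨even_two, by omega⟩
  simp only [cyclotomicOmega, eval_sub, eval_pow, eval_add, eval_X, eval_one]
  norm_num [hev.neg_one_pow]

/-- `ω_n′(T) = 2ⁿ (1+T)^{2ⁿ−1}`, so `ω_n′(−2) = −2ⁿ` in `ℤ`, for `n ≥ 1`. [folklore] -/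
theorem eval_neg_two_derivative_cyclotomicOmega {n : ℕ} (hn : 1 ≤ n) :
    (derivative (cyclotomicOmega 2 n)).eval (-2 : ℤ) = -2 ^ n := by
  have hodd : Odd (2 ^ n - 1) := by
    have hev : Even (2 ^ n) := Nat.even_pow.mpr ⟨even_two, by omega⟩
    exact Nat.Even.sub_odd Nat.one_le_two_pow hev odd_one
  have h1 : (cyclotomicOmega 2 n) = (X + C (1 : ℤ)) ^ 2 ^ n - 1 := by
    rw [cyclotomicOmega, map_one]
  rw [h1, derivative_sub, derivative_one, sub_zero, derivative_X_add_C_pow, eval_mul, eval_C,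
    eval_pow, eval_add, eval_X, eval_C, show (-2 : ℤ) + 1 = -1 by norm_num, hodd.neg_one_pow]
  push_cast
  ring

/-- `Φ_2(1+T) = T + 2` vanishes at `T = −2`. [folklore] -/
theorem eval_neg_two_cyclotomic_two_comp :
    ((cyclotomic (2 ^ 1) ℤ).comp (X + 1)).eval (-2 : ℤ) = 0 := by
  rw [pow_one, cyclotomic_two]
  simp

/-- `Φ_2(1+T) = T + 2` has derivative `1`. [folklore] -/
theorem eval_neg_two_derivative_cyclotomic_two_comp :
    (derivative ((cyclotomic (2 ^ 1) ℤ).comp (X + 1))).eval (-2 : ℤ) = 1 := by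
  rw [pow_one, cyclotomic_two]
  simp

/-- `Φ_{2^{m+2}}(1+T) = (1+T)^{2^{m+1}} + 1` as an element of `ℤ[T]`. [folklore] -/
theorem cyclotomic_two_pow_comp (m : ℕ) :
    (cyclotomic (2 ^ (m + 2)) ℤ).comp (X + 1) = (X + C (1 : ℤ)) ^ 2 ^ (m + 1) + 1 := by
  rw [cyclotomic_prime_pow_eq_geom_sum Nat.prime_two, Finset.sum_range_succ,
    Finset.sum_range_one, pow_zero, pow_one, add_comp, one_comp, pow_comp, X_comp, map_one,
    add_comm]

/-- `Φ_{2^{m+2}}(1+T)` takes the value `2` at `T = −2`. [folklore] -/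
theorem eval_neg_two_cyclotomic_two_pow_comp (m : ℕ) :
    ((cyclotomic (2 ^ (m + 2)) ℤ).comp (X + 1)).eval (-2 : ℤ) = 2 := by
  have hev : Even (2 ^ (m + 1)) := Nat.even_pow.mpr ⟨even_two, by omega⟩
  rw [cyclotomic_two_pow_comp, eval_add, eval_pow, eval_add, eval_X, eval_C, eval_one,
    show (-2 : ℤ) + 1 = -1 by norm_num, hev.neg_one_pow]
  norm_num

/-- `Φ_{2^{m+2}}(1+T)` has derivative `2^{m+1}(1+T)^{2^{m+1}−1}`, of value `−2^{m+1}` at `T = −2`.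
[folklore] -/
theorem eval_neg_two_derivative_cyclotomic_two_pow_comp (m : ℕ) :
    (derivative ((cyclotomic (2 ^ (m + 2)) ℤ).comp (X + 1))).eval (-2 : ℤ) = -2 ^ (m + 1) := by
  have hodd : Odd (2 ^ (m + 1) - 1) := by
    have hev : Even (2 ^ (m + 1)) := Nat.even_pow.mpr ⟨even_two, by omega⟩
    exact Nat.Even.sub_odd Nat.one_le_two_pow hev odd_one
  rw [cyclotomic_two_pow_comp, derivative_add, derivative_one, add_zero, derivative_X_add_C_pow,
    eval_mul, eval_C, eval_pow, eval_add, eval_X, eval_C, show (-2 : ℤ) + 1 = -1 by norm_num,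
    hodd.neg_one_pow]
  push_cast
  ring

/-! ## §3. The sequences `c_n = u_n(−2)`, `d_n = u_n′(−2)`, `e_n = v_n′(−2)` -/

/-- `c_n := u_n(−2) ∈ ℤ`, the value of Sprung's `u_n = sharpPoly a 2 n` at the blind point.
[cite: Sprung2017, Cor. 4.4 (the polynomials u_n)] -/
def cSeq (a : ℤ) (n : ℕ) : ℤ := (sharpPoly a 2 n).eval (-2)

/-- `d_n := u_n′(−2) ∈ ℤ`. [cite: Sprung2017, Cor. 4.4 (the polynomials u_n)] -/
def dSeq (a : ℤ) (n : ℕ) : ℤ := (derivative (sharpPoly a 2 n)).eval (-2)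

/-- `e_n := v_n′(−2) ∈ ℤ`. [cite: Sprung2017, Cor. 4.4 (the polynomials v_n)] -/
def eSeq (a : ℤ) (n : ℕ) : ℤ := (derivative (flatPoly a 2 n)).eval (-2)

/-- `Q_k := 4a c_k² − (a²+3) c_k c_{k+1} + a c_{k+1}²`, the telescoping antiderivative of
`(9 − a²) c_k c_{k+1}` along the Lucas recursion. [folklore] -/
def qSeq (a : ℤ) (k : ℕ) : ℤ :=
  4 * a * cSeq a k ^ 2 - (a ^ 2 + 3) * cSeq a k * cSeq a (k + 1) + a * cSeq a (k + 1) ^ 2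

/-- `P_n := Σ_{k<n} c_{k+1} c_{k+2}`. [folklore] -/
def pSum (a : ℤ) (n : ℕ) : ℤ := ∑ k ∈ Finset.range n, cSeq a (k + 1) * cSeq a (k + 2)

variable (a : ℤ)

/-- `c_0 = 0`. [folklore] -/
@[simp] theorem cSeq_zero : cSeq a 0 = 0 := by simp [cSeq]

/-- `c_1 = 1`. [folklore] -/
@[simp] theorem cSeq_one : cSeq a 1 = 1 := by simp [cSeq]

/-- `d_0 = 0`. [folklore] -/
@[simp] theorem dSeq_zero : dSeq a 0 = 0 := by simp [dSeq]

/-- `d_1 = 0`. [folklore] -/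
@[simp] theorem dSeq_one : dSeq a 1 = 0 := by simp [dSeq]

/-- `e_0 = 0`. [folklore] -/
@[simp] theorem eSeq_zero : eSeq a 0 = 0 := by simp [eSeq]

/-- `e_1 = 0`. [folklore] -/
@[simp] theorem eSeq_one : eSeq a 1 = 0 := by simp [eSeq]

/-- `v_n(−2) = 0` for `n ≥ 1` (`v_1 = 0`, `v_2 = −(T+2)`, recursion), in `ℤ`.
[cite: Sprung2017, Cor. 4.4] -/
theorem eval_neg_two_flatPoly' {n : ℕ} (hn : 1 ≤ n) : (flatPoly a 2 n).eval (-2 : ℤ) = 0 := by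
  have key : ∀ j, (flatPoly a 2 (j + 1)).eval (-2 : ℤ) = 0 ∧
      (flatPoly a 2 (j + 2)).eval (-2 : ℤ) = 0 := by
    intro j
    induction j with
    | zero =>
      refine ⟨by simp, ?_⟩
      rw [flatPoly_two, eval_neg, eval_neg_two_cyclotomic_two_comp, neg_zero]
    | succ j ih =>
      refine ⟨ih.2, ?_⟩
      rw [show j + 1 + 2 = (j + 1) + 2 by ring, flatPoly_add_two, eval_sub, eval_mul, eval_mul,
        show j + 1 + 1 = j + 2 by ring, ih.2, ih.1, mul_zero, mul_zero, sub_zero]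
  obtain ⟨j, rfl⟩ : ∃ j, n = j + 1 := ⟨n - 1, by omega⟩
  exact (key j).1

/-- **The Lucas recursion `c_{n+2} = a c_{n+1} − 2 c_n`** (`Φ_2(−1) = 0` kills the `n = 0` cyclotomic
term, where `c_0 = 0` anyway; `Φ_{2^{m+2}}(−1) = 2` for the others). [cite: Sprung2017, Cor. 4.4] -/
theorem cSeq_add_two (n : ℕ) : cSeq a (n + 2) = a * cSeq a (n + 1) - 2 * cSeq a n := by
  cases n with
  | zero =>
    simp only [cSeq, sharpPoly_add_two, eval_mul, eval_C, sharpPoly_zero, eval_zero,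
      mul_zero, sub_zero, zero_add]
  | succ m =>
    have hΦ := eval_neg_two_cyclotomic_two_pow_comp m
    rw [show m + 2 = m + 1 + 1 from rfl] at hΦ
    simp only [cSeq, sharpPoly_add_two, eval_sub, eval_mul, eval_C, hΦ]

/-- `c_2 = a`. [folklore] -/
theorem cSeq_two : cSeq a 2 = a := by
  rw [cSeq_add_two, cSeq_one, cSeq_zero]; ring

/-- **`e_{n+1} = −c_n`**: the derivative of `v_{n+1}` at `−2` is minus the value of `u_n`
(`v_{n+3}′ = a v_{n+2}′ − Φ′ v_{n+1} − Φ v_{n+1}′` with `v_{n+1}(−2) = 0`). [folklore] -/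
theorem eSeq_succ (n : ℕ) : eSeq a (n + 1) = -cSeq a n := by
  have key : ∀ j, eSeq a (j + 1) = -cSeq a j ∧ eSeq a (j + 2) = -cSeq a (j + 1) := by
    intro j
    induction j with
    | zero =>
      refine ⟨by simp, ?_⟩
      rw [eSeq, flatPoly_two, derivative_neg, eval_neg, eval_neg_two_derivative_cyclotomic_two_comp,
        cSeq_one]
    | succ j ih =>
      refine ⟨ih.2, ?_⟩
      have hv : (flatPoly a 2 (j + 1)).eval (-2 : ℤ) = 0 := eval_neg_two_flatPoly' a (by omega)
      have h2 := ih.2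
      have h1 := ih.1
      simp only [eSeq] at h1 h2 ⊢
      rw [show j + 1 + 2 = (j + 1) + 2 by ring, flatPoly_add_two, derivative_sub, derivative_mul,
        derivative_mul, derivative_C, zero_mul, zero_add, eval_sub, eval_mul, eval_add, eval_mul,
        eval_mul, eval_C, show j + 1 + 1 = j + 2 by ring, h2, hv, mul_zero, zero_add,
        eval_neg_two_cyclotomic_two_pow_comp, h1, cSeq_add_two]
      ring
  exact (key n).1

/-- `d_2 = 0` (`u_2 = a` is constant). [folklore] -/
theorem dSeq_two : dSeq a 2 = 0 := by
  simp [dSeq, sharpPoly_two]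

/-- **`d_{n+3} = a d_{n+2} − 2 d_{n+1} + 2^{n+1} c_{n+1}`** (`u_{n+3}′ = a u_{n+2}′ − Φ′ u_{n+1} − Φ u_{n+1}′`
with `Φ = Φ_{2^{n+2}}(1+T)`: `Φ(−2) = 2`, `Φ′(−2) = −2^{n+1}`). [folklore] -/
theorem dSeq_add_three (n : ℕ) :
    dSeq a (n + 3) = a * dSeq a (n + 2) - 2 * dSeq a (n + 1) + 2 ^ (n + 1) * cSeq a (n + 1) := by
  simp only [dSeq, cSeq]
  rw [show n + 3 = (n + 1) + 2 by ring, sharpPoly_add_two, derivative_sub, derivative_mul,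
    derivative_mul, derivative_C, zero_mul, zero_add, eval_sub, eval_mul, eval_add, eval_mul,
    eval_mul, eval_C, show n + 1 + 1 = n + 2 by ring, eval_neg_two_cyclotomic_two_pow_comp,
    eval_neg_two_derivative_cyclotomic_two_pow_comp]
  ring

/-- **Cassini**: `c_n c_{n+2} − c_{n+1}² = −2ⁿ`. [folklore] -/
theorem cSeq_mul_cSeq_add_two_sub_sq (n : ℕ) :
    cSeq a n * cSeq a (n + 2) - cSeq a (n + 1) ^ 2 = -2 ^ n := by
  induction n with
  | zero => simp [cSeq_two]
  | succ n ih =>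
    rw [show n + 1 + 2 = (n + 1) + 2 by ring, cSeq_add_two, show n + 1 + 1 = n + 2 by ring,
      pow_succ]
    have h := cSeq_add_two a n
    linear_combination (2 : ℤ) * ih - (cSeq a (n + 2)) * h

/-- `e_{n+1} c_{n+2} − e_{n+2} c_{n+1} = 2ⁿ` (Cassini, through `e_{m+1} = −c_m`). [folklore] -/
theorem eSeq_mul_cSeq_sub (n : ℕ) :
    eSeq a (n + 1) * cSeq a (n + 2) - eSeq a (n + 2) * cSeq a (n + 1) = 2 ^ n := by
  rw [eSeq_succ, show n + 2 = (n + 1) + 1 by ring, eSeq_succ]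
  have h := cSeq_mul_cSeq_add_two_sub_sq a n
  rw [show n + 1 + 1 = n + 2 by ring]
  linear_combination -h

/-- `P_0 = 0`. [folklore] -/
@[simp] theorem pSum_zero : pSum a 0 = 0 := by simp [pSum]

/-- `P_{n+1} = P_n + c_{n+1} c_{n+2}`. [folklore] -/
theorem pSum_succ (n : ℕ) : pSum a (n + 1) = pSum a n + cSeq a (n + 1) * cSeq a (n + 2) := by
  rw [pSum, Finset.sum_range_succ, pSum]

/-- **The Wronskian sum**: `d_{n+2} c_{n+1} − d_{n+1} c_{n+2} = 2ⁿ · Σ_{k<n} c_{k+1} c_{k+2}`.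
[folklore] -/
theorem dSeq_wronskian (n : ℕ) :
    dSeq a (n + 2) * cSeq a (n + 1) - dSeq a (n + 1) * cSeq a (n + 2) = 2 ^ n * pSum a n := by
  induction n with
  | zero => simp [dSeq_two]
  | succ n ih =>
    rw [show n + 1 + 2 = n + 3 by ring, dSeq_add_three, pSum_succ, show n + 1 + 1 = n + 2 by ring,
      pow_succ]
    have hc := cSeq_add_two a (n + 1)
    rw [show n + 1 + 2 = n + 3 by ring, show n + 1 + 1 = n + 2 by ring] at hc
    linear_combination (2 : ℤ) * ih - dSeq a (n + 2) * hc

/-- `Q_{k+1} − Q_k = (9 − a²) c_k c_{k+1}`. [folklore] -/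
theorem qSeq_succ_sub (k : ℕ) : qSeq a (k + 1) - qSeq a k = (9 - a ^ 2) * (cSeq a k * cSeq a (k + 1)) := by
  simp only [qSeq]
  rw [show k + 1 + 1 = k + 2 by ring, cSeq_add_two]
  ring

/-- `Q_1 = a`. [folklore] -/
theorem qSeq_one : qSeq a 1 = a := by
  rw [qSeq, show (1 : ℕ) + 1 = 2 from rfl, cSeq_one, cSeq_two]
  ring

/-- **Telescoping**: `(9 − a²) · Σ_{k<n} c_{k+1} c_{k+2} = Q_{n+1} − a`. [folklore] -/
theorem sub_sq_mul_pSum (n : ℕ) : (9 - a ^ 2) * pSum a n = qSeq a (n + 1) - a := by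
  induction n with
  | zero => simp [qSeq_one]
  | succ n ih =>
    rw [pSum_succ, mul_add, ih, show n + 1 + 1 = n + 2 by ring]
    have h := qSeq_succ_sub a (n + 1)
    rw [show n + 1 + 1 = n + 2 by ring] at h
    linear_combination (-1 : ℤ) * h

/-- **`2`-adic decay of `c_n` for even `a`**: `2^k ∣ c_n` whenever `2k + 1 ≤ n`. [folklore] -/
theorem pow_dvd_cSeq (ha : (2 : ℤ) ∣ a) : ∀ n k : ℕ, 2 * k + 1 ≤ n → (2 : ℤ) ^ k ∣ cSeq a n := by
  have key : ∀ n k : ℕ, (2 * k + 1 ≤ n → (2 : ℤ) ^ k ∣ cSeq a n) ∧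
      (2 * k + 1 ≤ n + 1 → (2 : ℤ) ^ k ∣ cSeq a (n + 1)) := by
    intro n
    induction n with
    | zero =>
      intro k
      refine ⟨fun h ↦ by omega, fun h ↦ ?_⟩
      obtain rfl : k = 0 := by omega
      simp
    | succ n ih =>
      intro k
      refine ⟨(ih k).2, fun hk ↦ ?_⟩
      rw [show n + 1 + 1 = n + 2 by ring, cSeq_add_two]
      rcases k with _ | k
      · simp
      · have h1 : (2 : ℤ) ^ k ∣ cSeq a (n + 1) := (ih k).2 (by omega)
        have h0 : (2 : ℤ) ^ k ∣ cSeq a n := (ih k).1 (by omega)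
        rw [pow_succ]
        exact dvd_sub (mul_comm a _ ▸ mul_dvd_mul h1 ha) (by
          rw [mul_comm (2 : ℤ) (cSeq a n)]; exact mul_dvd_mul h0 dvd_rfl)
  exact fun n k ↦ (key n k).1

/-- `2^{2k} ∣ Q_n` whenever `2k + 1 ≤ n`. [folklore] -/
theorem pow_dvd_qSeq (ha : (2 : ℤ) ∣ a) {n k : ℕ} (h : 2 * k + 1 ≤ n) :
    (2 : ℤ) ^ (2 * k) ∣ qSeq a n := by
  have h1 : (2 : ℤ) ^ k ∣ cSeq a n := pow_dvd_cSeq a ha n k h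
  have h2 : (2 : ℤ) ^ k ∣ cSeq a (n + 1) := pow_dvd_cSeq a ha (n + 1) k (by omega)
  have hkk : (2 : ℤ) ^ (2 * k) = 2 ^ k * 2 ^ k := by rw [two_mul, pow_add]
  rw [qSeq, hkk]
  refine dvd_add (dvd_sub ?_ ?_) ?_
  · rw [pow_two]
    exact (mul_dvd_mul h1 h1).mul_left _
  · rw [mul_assoc]
    exact (mul_dvd_mul h1 h2).mul_left _
  · rw [pow_two]
    exact (mul_dvd_mul h2 h2).mul_left _

end BlindFlat

end Summit.BirchSwinnertonDyer.Rank1Residual.Supersingular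

end
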